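import Literature.Analysis.FluidPDE.PeriodicLerayLimitWeakForm
import Literature.Analysis.FluidPDE.MollifiedLerayDistributional
import Literature.Analysis.FluidPDE.PeriodicLerayGalerkinSystem
import Mathlib.Analysis.SpecialFunctions.SmoothTransition
import HarnessLib

/-!
# [BT1] weak formulation of the (mollified, perturbed) Leray system: one period against `𝒟_T`
  versus the whole line against compactly supported test fields

Analysis/FluidPDE proof file (theorems only; no definitions, no named facts) in the DAG below the
named fact `Literature.Analysis.FluidPDE.bradshawTsai2017_thm_2_4_mollified`
(`PeriodicLerayExistence.lean`; Bradshaw–Tsai, Ann. Henri Poincaré 18 (2017) = arXiv:1510.07504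
[BT1], Lemma 2.6 and the first part of the proof of Thm 2.4). The weak formulation of a
`T`-periodic weak solution is printed, and recorded in clause (iii) of
`IsMollifiedPeriodicWeakSolution.weakForm`, as an identity *integrated over one period* against
the periodic test class `𝒟_T` ([BT1] §1: "smooth divergence free vector fields in `ℝ³ × ℝ` which
are time periodic with period `T` and whose supports are compact in space"):

  `∫₀ᵀ ( ∫ (⟪U, ∂ₛf⟫ − ∇U : ∇f + ⟪F, f⟫) dy − ⟨LW(s), f(s)⟩ ) ds = 0`,  `f ∈ 𝒟_T`,

(`F` collecting the zeroth-order terms, in [BT1] `F = U + y·∇U − b·∇U − U·∇W − W·∇W`), whereas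
the pressure (`distributional` clause, `MollifiedLerayDistributional`) and the local energy
balance (`StokesLocalEnergyEquality`) are statements *on the whole line* `ℝ × ℝ³` against
compactly supported test fields. This file proves that for `T`-periodic data the two formulations
are equivalent (`BradshawTsai2017.weakForm_line_of_period`, `BradshawTsai2017.weakForm_period_of_line`):

* period ⇒ line: a compactly supported test field `ψ` with divergence-free slices is
  *periodised in time*, `f(s) = Σₙ ψ(s + nT) ∈ 𝒟_T` (a locally finite sum), and by periodicity of
  the data the identity over one period for `f` unfolds into the identity over `ℝ` for `ψ`
  (`integral_eq_setIntegral_sum_comp_add_int_mul`: `∫_ℝ c = ∫₀ᵀ Σₙ c(s + nT)`);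
* line ⇒ period: a field `f ∈ 𝒟_T` is cut off in time by a smooth `χ` with
  `χ(s) + χ(s + T) = 1` on `[0, T]`, `supp χ ⊆ [0, 2T]` (`exists_smooth_period_cutoff`, from
  Mathlib's `Real.smoothTransition`); the line identity for `χf` is
  `∫ χ A + ∫ χ' B = ∫₀ᵀ (χ(s) + χ(s+T)) A(s) ds + ∫₀ᵀ (χ' (s) + χ'(s+T)) B(s) ds = ∫₀ᵀ A`.

Both directions rest on the linearity of the slice functional in the test slice (for almost
every time, where the slices of the data are locally integrable: `ae_locallyIntegrable_slice`)
and on its periodicity in time. The data are abstract: `U`, `F` locally integrable `T`-periodic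
fields, `G` a locally integrable `T`-periodic operator field (the weak gradient), `W` a `C¹`
`T`-periodic profile entering through the accepted pairing `lerayPairing` — so that the two
theorems apply verbatim to clause (iii) (with
`F = U + (∇U)y − (∇U)(W + η_ε * U) − DW U − DW W`) and to its `ε → 0` limit.

## Mathlib / tree search

Tree (reused): `lerayPairing`, `IsPeriodicDivFreeTest` (`PeriodicLeraySystem`,
`PeriodicLerayExistence`); `IsPeriodicDivFreeTest.exists_ball`, `timeDeriv_eq_fderiv_uncurry`,
`continuous_timeDeriv_of_contDiff_one` (`PeriodicLerayLimitWeakForm`);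
`IsSpaceTimeTestOn.timeDeriv_top/fderiv_top`, `exists_subset_Icc_prod_univ_of_isCompact`
(`HeatDuhamelBack`, `MollifiedLerayDistributional`). `lean search 'periodi[sz]'`: the tree
periodises *solutions* in time (`PeriodicLerayGradient`, `PeriodicLerayLimitPeriodicity`) and test
functions in *space* (`WeakSolutionLift`, torus files); no time-periodisation of space–time test
fields and no period/line bridge for weak formulations. Mathlib: `finsum_eq_sum_of_support_subset`,
`integral_add_right_eq_self`, `Integrable.prod_right_ae`, `Real.smoothTransition`.

## References

* Z. Bradshaw, T.-P. Tsai, *Forward discretely self-similar solutions of the Navier–Stokes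
  equations II*, Ann. Henri Poincaré 18 (2017) 1095–1119 = arXiv:1510.07504, §1 (the class
  `𝒟_T`), §2 (weak formulation of the mollified perturbed Leray system; proof of Thm 2.4)
  [BradshawTsai2017AHP].
* R. Temam, *Navier–Stokes Equations*, North-Holland 1977, Ch. III §1 (weak formulations in
  time: test functions on a period versus on the line).
-/

noncomputable section

open MeasureTheory Set Function Filter Topology TopologicalSpace Metric
open scoped NNReal ENNReal InnerProductSpace RealInnerProductSpace ContDiff

namespace Literature.Analysis.FluidPDE

namespace BradshawTsai2017

/-! ### Unfolding an integral over the line onto one period -/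

section Unfold

variable {T : ℝ}

/-- Two period cells `(mT, mT + T]`, `(nT, nT + T]` sharing a point coincide. [folklore] -/
theorem int_eq_of_mem_Ioc_period (hT : 0 < T) {t : ℝ} {m n : ℤ}
    (hm : t ∈ Ioc ((m : ℝ) * T) ((m : ℝ) * T + T)) (hn : t ∈ Ioc ((n : ℝ) * T) ((n : ℝ) * T + T)) :
    m = n := by
  have h1 : (m : ℝ) < n + 1 := by
    have : (m : ℝ) * T < ((n : ℝ) + 1) * T := by nlinarith [hm.1, hn.2]
    exact lt_of_mul_lt_mul_right this hT.le
  have h2 : (n : ℝ) < m + 1 := by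
    have : (n : ℝ) * T < ((m : ℝ) + 1) * T := by nlinarith [hn.1, hm.2]
    exact lt_of_mul_lt_mul_right this hT.le
  have h1' : m < n + 1 := by exact_mod_cast h1
  have h2' : n < m + 1 := by exact_mod_cast h2
  omega

/-- Every real number lies in the period cell `(nT, nT + T]` with `n = ⌈t/T⌉ - 1`. [folklore] -/
theorem mem_Ioc_period (hT : 0 < T) (t : ℝ) :
    t ∈ Ioc (((⌈t / T⌉ - 1 : ℤ) : ℝ) * T) (((⌈t / T⌉ - 1 : ℤ) : ℝ) * T + T) := by
  have h1 := Int.ceil_lt_add_one (t / T)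
  have h2 := Int.le_ceil (t / T)
  push_cast
  constructor
  · have : ((⌈t / T⌉ : ℝ) - 1) < t / T := by linarith
    have := (lt_div_iff₀ hT).1 this
    linarith
  · have := (div_le_iff₀ hT).1 h2
    linarith

/-- The cell index of a point of `[-M, M]` is at most `M/T + 1` in absolute value. [folklore] -/
theorem abs_index_le_of_mem_Ioc_period (hT : 0 < T) {M t : ℝ} (ht : |t| ≤ M) {n : ℤ}
    (hn : t ∈ Ioc ((n : ℝ) * T) ((n : ℝ) * T + T)) : |(n : ℝ)| ≤ M / T + 1 := by
  rw [abs_le] at ht ⊢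
  constructor
  · -- `t ≤ nT + T` and `-M ≤ t`
    have h : -M ≤ (n : ℝ) * T + T := ht.1.trans hn.2
    have h' : (-(M / T + 1)) * T = -M - T := by field_simp; ring
    by_contra hc
    push Not at hc
    have := mul_lt_mul_of_pos_right hc hT
    rw [h'] at this
    linarith
  · have h : (n : ℝ) * T < M := hn.1.trans_le ht.2
    have h' : (M / T + 1) * T = M + T := by field_simp
    by_contra hc
    push Not at hc
    have := mul_lt_mul_of_pos_right hc hT
    rw [h'] at this
    nlinarith

/-- **Unfolding an integral over the line onto one period.** If `c` is integrable on `ℝ` and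
vanishes off the cells `(nT, nT + T]`, `n ∈ S` (`S` finite), then
`∫_ℝ c = ∫_{(0,T]} Σ_{n ∈ S} c(s + nT) ds`. [folklore] -/
theorem integral_eq_setIntegral_sum_comp_add_int_mul {F' : Type*} [NormedAddCommGroup F']
    [NormedSpace ℝ F'] (hT : 0 < T) {c : ℝ → F'} (hc : Integrable c) (S : Finset ℤ)
    (hS : ∀ t, c t ≠ 0 → ∃ n ∈ S, t ∈ Ioc ((n : ℝ) * T) ((n : ℝ) * T + T)) :
    ∫ t, c t = ∫ s in Ioc 0 T, ∑ n ∈ S, c (s + n * T) := by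
  -- pointwise: `c = Σ_{n ∈ S} 1_{(nT, nT+T]} c`
  have hpt : ∀ t, c t = ∑ n ∈ S, (Ioc ((n : ℝ) * T) ((n : ℝ) * T + T)).indicator c t := by
    intro t
    by_cases hct : c t = 0
    · rw [hct]
      symm
      refine Finset.sum_eq_zero fun n _ => ?_
      by_cases ht : t ∈ Ioc ((n : ℝ) * T) ((n : ℝ) * T + T)
      · rw [indicator_of_mem ht, hct]
      · rw [indicator_of_notMem ht]
    · obtain ⟨n, hnS, hn⟩ := hS t hct
      rw [Finset.sum_eq_single_of_mem n hnS]
      · rw [indicator_of_mem hn]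
      · intro m _ hmn
        rw [indicator_of_notMem]
        intro hm
        exact hmn (int_eq_of_mem_Ioc_period hT hm hn)
  -- each cell integral is a translate of the integral over `(0, T]`
  have hcell : ∀ n : ℤ, ∫ t, (Ioc ((n : ℝ) * T) ((n : ℝ) * T + T)).indicator c t =
      ∫ s in Ioc 0 T, c (s + n * T) := by
    intro n
    rw [← integral_add_right_eq_self _ ((n : ℝ) * T), ← integral_indicator measurableSet_Ioc]
    refine integral_congr_ae (Eventually.of_forall fun s => ?_)
    show (Ioc ((n : ℝ) * T) ((n : ℝ) * T + T)).indicator c (s + n * T) =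
      (Ioc (0 : ℝ) T).indicator (fun s => c (s + n * T)) s
    by_cases hs : s ∈ Ioc (0 : ℝ) T
    · rw [indicator_of_mem hs, indicator_of_mem]
      exact ⟨by linarith [hs.1], by linarith [hs.2]⟩
    · rw [indicator_of_notMem hs, indicator_of_notMem]
      rintro ⟨h1, h2⟩
      exact hs ⟨by linarith, by linarith⟩
  have hint : ∀ n : ℤ, Integrable ((Ioc ((n : ℝ) * T) ((n : ℝ) * T + T)).indicator c) :=
    fun n => hc.indicator measurableSet_Ioc
  have hint' : ∀ n : ℤ, IntegrableOn (fun s => c (s + n * T)) (Ioc 0 T) :=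
    fun n => (hc.comp_add_right ((n : ℝ) * T)).integrableOn
  calc ∫ t, c t = ∫ t, ∑ n ∈ S, (Ioc ((n : ℝ) * T) ((n : ℝ) * T + T)).indicator c t :=
        integral_congr_ae (Eventually.of_forall hpt)
    _ = ∑ n ∈ S, ∫ t, (Ioc ((n : ℝ) * T) ((n : ℝ) * T + T)).indicator c t :=
        integral_finsetSum _ fun n _ => hint n
    _ = ∑ n ∈ S, ∫ s in Ioc 0 T, c (s + n * T) := Finset.sum_congr rfl fun n _ => hcell n
    _ = ∫ s in Ioc 0 T, ∑ n ∈ S, c (s + n * T) :=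
        (integral_finsetSum _ fun n _ => hint' n).symm

end Unfold

/-! ### A smooth cut-off resolving the unit over the periods -/

section Cutoff

variable {T : ℝ}

/-- **A smooth partition of unity subordinate to the periods.** For `T > 0` there is a smooth
`χ : ℝ → ℝ` vanishing on `(-∞, 0]` and on `[2T, ∞)` with `χ(s) + χ(s + T) = 1` for `s ∈ [0, T]`
(hence `χ'(s) + χ'(s + T) = 0` for `s ∈ (0, T)`): `χ(t) = h(t/T) − h(t/T − 1)` for Mathlib's
smooth transition `h` (`0` on `(-∞,0]`, `1` on `[1,∞)`). [folklore] -/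
theorem exists_smooth_period_cutoff (hT : 0 < T) :
    ∃ χ : ℝ → ℝ, ContDiff ℝ (⊤ : ℕ∞) χ ∧ (∀ t, t ≤ 0 → χ t = 0) ∧ (∀ t, 2 * T ≤ t → χ t = 0) ∧
      (∀ s ∈ Icc (0 : ℝ) T, χ s + χ (s + T) = 1) ∧
      (∀ s ∈ Ioo (0 : ℝ) T, deriv χ s + deriv χ (s + T) = 0) := by
  set χ : ℝ → ℝ := fun t => Real.smoothTransition (t / T) - Real.smoothTransition (t / T - 1)
    with hχ
  have hχs : ContDiff ℝ (⊤ : ℕ∞) χ := by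
    have h1 : ContDiff ℝ (⊤ : ℕ∞) fun t : ℝ => t / T := contDiff_id.div_const T
    exact (Real.smoothTransition.contDiff.comp h1).sub
      (Real.smoothTransition.contDiff.comp (h1.sub contDiff_const))
  have hsum : ∀ s ∈ Icc (0 : ℝ) T, χ s + χ (s + T) = 1 := by
    intro s hs
    have e1 : (s + T) / T = s / T + 1 := by field_simp
    have hs0 : 0 ≤ s / T := div_nonneg hs.1 hT.le
    have hs1 : s / T ≤ 1 := (div_le_one hT).2 hs.2
    simp only [hχ, e1, add_sub_cancel_right]
    rw [Real.smoothTransition.zero_of_nonpos (x := s / T - 1) (by linarith),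
      Real.smoothTransition.one_of_one_le (x := s / T + 1) (by linarith)]
    ring
  refine ⟨χ, hχs, fun t ht => ?_, fun t ht => ?_, hsum, fun s hs => ?_⟩
  · have h0 : t / T ≤ 0 := div_nonpos_of_nonpos_of_nonneg ht hT.le
    simp only [hχ]
    rw [Real.smoothTransition.zero_of_nonpos h0,
      Real.smoothTransition.zero_of_nonpos (x := t / T - 1) (by linarith)]
    ring
  · have h2 : 2 ≤ t / T := (le_div_iff₀ hT).2 (by linarith)
    simp only [hχ]
    rw [Real.smoothTransition.one_of_one_le (x := t / T) (by linarith),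
      Real.smoothTransition.one_of_one_le (x := t / T - 1) (by linarith)]
    ring
  · -- differentiate `χ(s) + χ(s + T) = 1` on the open interval
    have hd : Differentiable ℝ χ := hχs.differentiable (by simp)
    have hev : (fun s' => χ s' + χ (s' + T)) =ᶠ[𝓝 s] fun _ => (1 : ℝ) := by
      filter_upwards [Ioo_mem_nhds hs.1 hs.2] with s' hs'
      exact hsum s' (Ioo_subset_Icc_self hs')
    have h1 : deriv (fun s' => χ s' + χ (s' + T)) s = 0 := by
      rw [hev.deriv_eq, deriv_const]
    have h2 : deriv (fun s' => χ s' + χ (s' + T)) s = deriv χ s + deriv χ (s + T) := by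
      have hc : HasDerivAt (fun s' => χ (s' + T)) (deriv χ (s + T)) s := by
        have := ((hd (s + T)).hasDerivAt).comp_add_const s T
        simpa using this
      exact ((hd s).hasDerivAt.add hc).deriv
    rw [← h2, h1]

end Cutoff

/-! ### Time-periodisation of a compactly supported space–time test field -/

section Periodize

variable {T : ℝ}

/-- The integers `n` with `|s + nT| ≤ M` for some `|s| < L` form a finite set. [folklore] -/
theorem exists_finset_window (hT : 0 < T) (M L : ℝ) :
    ∃ S : Finset ℤ, ∀ s : ℝ, |s| < L → ∀ n : ℤ, |s + n * T| ≤ M → n ∈ S := by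
  refine ⟨Finset.Icc (-⌈(M + L) / T⌉) ⌈(M + L) / T⌉, fun s hs n hn => ?_⟩
  rw [Finset.mem_Icc]
  have h1 : |(n : ℝ) * T| ≤ M + L := by
    calc |(n : ℝ) * T| = |(s + n * T) - s| := by ring_nf
      _ ≤ |s + n * T| + |s| := abs_sub _ _
      _ ≤ M + L := by linarith
  rw [abs_mul, abs_of_pos hT] at h1
  have h2 : |(n : ℝ)| ≤ (M + L) / T := (le_div_iff₀ hT).2 h1
  have h3 : |(n : ℝ)| ≤ ⌈(M + L) / T⌉ := h2.trans (Int.le_ceil _)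
  rw [abs_le] at h3
  obtain ⟨h3a, h3b⟩ := h3
  constructor
  · exact_mod_cast h3a
  · exact_mod_cast h3b

/-- A space–time test field, its time derivative and its slice derivatives vanish outside a
bounded time interval `[-M, M]` and outside a ball in space. [folklore] -/
theorem exists_time_space_support {F' : Type*} [NormedAddCommGroup F'] [NormedSpace ℝ F']
    {ψ : ℝ → (EuclideanSpace ℝ (Fin 3)) → F'} (hψ : IsSpaceTimeTestOn (⊤ : Opens (ℝ × (EuclideanSpace ℝ (Fin 3)))) ψ) :
    ∃ M R : ℝ, 0 ≤ M ∧ 0 < R ∧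
      (∀ t y, M < |t| → ψ t y = 0 ∧ timeDeriv ψ t y = 0 ∧ fderiv ℝ (ψ t) y = 0) ∧
      (∀ t y, R ≤ ‖y‖ → ψ t y = 0 ∧ timeDeriv ψ t y = 0 ∧ fderiv ℝ (ψ t) y = 0) := by
  set K := tsupport (uncurry ψ) with hK
  have hKc : IsCompact K := hψ.hasCompactSupport
  obtain ⟨a, b, hab⟩ := exists_subset_Icc_prod_univ_of_isCompact hKc
  have h2 : IsCompact (Prod.snd '' K) := hKc.image continuous_snd
  obtain ⟨R₀, hR₀⟩ := h2.isBounded.subset_closedBall (0 : (EuclideanSpace ℝ (Fin 3)))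
  have hout : ∀ t y, (t, y) ∉ K → ψ t y = 0 ∧ timeDeriv ψ t y = 0 ∧ fderiv ℝ (ψ t) y = 0 :=
    fun t y h => ⟨(image_eq_zero_of_notMem_tsupport h : uncurry ψ (t, y) = 0),
      IsSpaceTimeTestOn.timeDeriv_eq_zero_of_notMem h,
      IsSpaceTimeTestOn.fderiv_slice_eq_zero_of_notMem h⟩
  refine ⟨max |a| |b|, |R₀| + 1, by positivity, by positivity, fun t y ht => hout t y ?_,
    fun t y hy => hout t y ?_⟩
  · intro hmem
    have ht' := (hab hmem).1
    have h1 : |t| ≤ max |a| |b| := abs_le_max_abs_abs ht'.1 ht'.2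
    linarith
  · intro hmem
    have hy' : y ∈ closedBall (0 : (EuclideanSpace ℝ (Fin 3))) R₀ := hR₀ ⟨(t, y), hmem, rfl⟩
    rw [mem_closedBall_zero_iff] at hy'
    linarith [le_abs_self R₀]

/-- **Time-periodisation of a test field.** For `T > 0` and a space–time test field `ψ` on
`ℝ × ℝ³` with divergence-free slices, the locally finite sum `f(s, y) = Σₙ ψ(s + nT, y)` belongs
to `𝒟_T`, and on the window `(-T, 2T)` it is the finite sum over a fixed finite set `S` of
periods, together with its time derivative and slice derivatives; `S` also indexes every
period cell meeting the time support `[-M, M]` of `ψ`. [folklore] -/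
theorem exists_periodization (hT : 0 < T) {ψ : ℝ → (EuclideanSpace ℝ (Fin 3)) → (EuclideanSpace ℝ (Fin 3))}
    (hψ : IsSpaceTimeTestOn (⊤ : Opens (ℝ × (EuclideanSpace ℝ (Fin 3)))) ψ)
    (hdiv : ∀ t, VectorCalculus.IsDivFree (ψ t)) :
    ∃ (f : ℝ → (EuclideanSpace ℝ (Fin 3)) → (EuclideanSpace ℝ (Fin 3))) (S : Finset ℤ) (M : ℝ), IsPeriodicDivFreeTest T f ∧
      (∀ t y, M < |t| → ψ t y = 0 ∧ timeDeriv ψ t y = 0 ∧ fderiv ℝ (ψ t) y = 0) ∧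
      (∀ (n : ℤ) (t : ℝ), |t| ≤ M → t ∈ Ioc ((n : ℝ) * T) ((n : ℝ) * T + T) → n ∈ S) ∧
      (∀ s ∈ Ioo (-T) (2 * T), ∀ y, f s y = ∑ n ∈ S, ψ (s + n * T) y) ∧
      (∀ s ∈ Ioo (-T) (2 * T), ∀ y, timeDeriv f s y = ∑ n ∈ S, timeDeriv ψ (s + n * T) y) ∧
      (∀ s ∈ Ioo (-T) (2 * T), ∀ y,
        fderiv ℝ (f s) y = ∑ n ∈ S, fderiv ℝ (ψ (s + n * T)) y) := by
  obtain ⟨M, R, hM0, hR0, htime, hspace⟩ := exists_time_space_support hψ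
  have hsmooth : ContDiff ℝ (⊤ : ℕ∞) (uncurry ψ) := hψ.contDiff
  -- the periodisation
  set f : ℝ → (EuclideanSpace ℝ (Fin 3)) → (EuclideanSpace ℝ (Fin 3)) := fun s y => ∑ᶠ n : ℤ, ψ (s + n * T) y with hf
  -- finite representation on time windows `|s| < L`
  have hwin : ∀ L : ℝ, ∃ S : Finset ℤ, (∀ s : ℝ, |s| < L → ∀ n : ℤ, |s + n * T| ≤ M → n ∈ S) ∧
      ∀ s : ℝ, |s| < L → ∀ y, f s y = ∑ n ∈ S, ψ (s + n * T) y := by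
    intro L
    obtain ⟨S, hS⟩ := exists_finset_window hT M L
    refine ⟨S, hS, fun s hs y => ?_⟩
    simp only [hf]
    refine finsum_eq_sum_of_support_subset _ fun n hn => ?_
    rw [Finset.mem_coe]
    refine hS s hs n ?_
    by_contra hlt
    push Not at hlt
    exact hn (htime _ y hlt).1
  -- smoothness: locally a finite sum of translates
  have hcd : ContDiff ℝ (⊤ : ℕ∞) (uncurry f) := by
    rw [contDiff_iff_contDiffAt]
    rintro ⟨s₀, y₀⟩
    obtain ⟨S, -, hS⟩ := hwin (|s₀| + 1)
    have hev : uncurry f =ᶠ[𝓝 (s₀, y₀)] fun z => ∑ n ∈ S, uncurry ψ (z.1 + n * T, z.2) := by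
      have ho : IsOpen {z : ℝ × (EuclideanSpace ℝ (Fin 3)) | |z.1| < |s₀| + 1} :=
        isOpen_lt (continuous_abs.comp continuous_fst) continuous_const
      filter_upwards [ho.mem_nhds (show |(s₀, y₀).1| < |s₀| + 1 by simp)] with z hz
      exact hS z.1 hz z.2
    refine ContDiffAt.congr_of_eventuallyEq ?_ hev
    refine ContDiff.contDiffAt (ContDiff.sum fun n _ => ?_)
    exact hsmooth.comp ((contDiff_fst.add contDiff_const).prodMk contDiff_snd)
  -- periodicity
  have hper : ∀ s y, f (s + T) y = f s y := by
    intro s y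
    simp only [hf]
    conv_rhs => rw [← finsum_comp_equiv (Equiv.addRight (1 : ℤ))]
    refine finsum_congr fun n => ?_
    simp only [Equiv.coe_addRight, Int.cast_add, Int.cast_one]
    ring_nf
  -- space support
  have hsp : ∀ s y, R ≤ ‖y‖ → f s y = 0 := by
    intro s y hy
    simp only [hf]
    exact finsum_eq_zero_of_forall_eq_zero fun n => (hspace _ y hy).1
  -- divergence free slices
  have hdivf : ∀ s, VectorCalculus.IsDivFree (f s) := by
    intro s y
    obtain ⟨S, -, hS⟩ := hwin (|s| + 1)
    have hfs : f s = fun y => ∑ n ∈ S, ψ (s + n * T) y := funext fun y => hS s (by linarith) y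
    have hd : ∀ n ∈ S, DifferentiableAt ℝ (ψ (s + n * T)) y := fun n _ =>
      ((hψ.contDiff_slice _).differentiable (by simp)) y
    rw [VectorCalculus.divergence, hfs, fderiv_fun_sum hd, ContinuousLinearMap.toLinearMap_sum
      ] at *
    rw [map_sum]
    exact Finset.sum_eq_zero fun n _ => hdiv (s + n * T) y
  -- the window `(-T, 2T)`
  obtain ⟨S, hSM, hS⟩ := hwin (2 * T + 1)
  have hwinS : ∀ s ∈ Ioo (-T) (2 * T), |s| < 2 * T + 1 := fun s hs => by
    rw [abs_lt]; constructor <;> linarith [hs.1, hs.2]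
  refine ⟨f, S, M, ⟨hcd, hper, hdivf, ⟨R, hsp⟩⟩, htime, fun n t ht hn => ?_, fun s hs y =>
    hS s (hwinS s hs) y, fun s hs y => ?_, fun s hs y => ?_⟩
  · -- coverage of the cells meeting `[-M, M]`
    have e : t = (t - n * T) + n * T := by ring
    refine hSM (t - n * T) ?_ n (by rw [← e]; exact ht)
    rw [abs_lt]; constructor <;> nlinarith [hn.1, hn.2]
  · -- the time derivative on the window
    have ho : IsOpen (Ioo (-T) (2 * T)) := isOpen_Ioo
    have hev : (fun s' => f s' y) =ᶠ[𝓝 s] fun s' => ∑ n ∈ S, ψ (s' + n * T) y := by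
      filter_upwards [ho.mem_nhds hs] with s' hs'
      exact hS s' (hwinS s' hs') y
    rw [timeDeriv, hev.deriv_eq]
    have hd : ∀ n ∈ S, DifferentiableAt ℝ (fun s' => ψ (s' + n * T) y) s := by
      intro n _
      have h1 : Differentiable ℝ (uncurry ψ) := hsmooth.differentiable (by simp)
      have h2 : Differentiable ℝ fun s' : ℝ => (s' + n * T, y) :=
        (differentiable_id.add_const _).prodMk (differentiable_const _)
      exact (h1.comp h2) s
    rw [deriv_fun_sum hd]
    refine Finset.sum_congr rfl fun n _ => ?_
    rw [timeDeriv, ← deriv_comp_add_const]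
  · -- the slice derivative on the window
    have hfs : f s = fun y => ∑ n ∈ S, ψ (s + n * T) y := funext fun y => hS s (hwinS s hs) y
    have hd : ∀ n ∈ S, DifferentiableAt ℝ (ψ (s + n * T)) y := fun n _ =>
      ((hψ.contDiff_slice _).differentiable (by simp)) y
    rw [hfs, fderiv_fun_sum hd]

end Periodize

/-! ### Periodic data: iterated periods, slices, integrability of the pairings -/

section Data

variable {T : ℝ}

/-- A `T`-periodic time-dependent field is `nT`-periodic for every integer `n`. [folklore] -/
theorem apply_add_int_mul_of_periodic {X Y : Type*} {H : ℝ → X → Y}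
    (h : ∀ s x, H (s + T) x = H s x) (n : ℤ) (s : ℝ) (x : X) : H (s + n * T) x = H s x := by
  have hp : Function.Periodic H T := fun s => funext (h s)
  exact congrFun (hp.int_mul n s) x

/-- **Almost every time slice of a locally integrable space–time field is locally integrable.**
[folklore] -/
theorem ae_locallyIntegrable_slice {X : Type*} [NormedAddCommGroup X] {H : ℝ → (EuclideanSpace ℝ (Fin 3)) → X}
    (hH : LocallyIntegrable (uncurry H) volume) : ∀ᵐ s : ℝ, LocallyIntegrable (H s) volume := by
  have hm : ∀ m : ℕ, ∀ᵐ s : ℝ, s ∈ Icc (-(m : ℝ)) m →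
      IntegrableOn (H s) (closedBall (0 : (EuclideanSpace ℝ (Fin 3))) m) volume := by
    intro m
    have hK : IsCompact (Icc (-(m : ℝ)) m ×ˢ closedBall (0 : (EuclideanSpace ℝ (Fin 3))) m) :=
      isCompact_Icc.prod (isCompact_closedBall _ _)
    have hi := hH.integrableOn_isCompact hK
    rw [IntegrableOn, Measure.volume_eq_prod, ← Measure.prod_restrict] at hi
    have h2 := hi.prod_right_ae
    rw [ae_restrict_iff' measurableSet_Icc] at h2
    exact h2
  rw [← ae_all_iff] at hm
  filter_upwards [hm] with s hs
  refine locallyIntegrable_iff.2 fun K hK => ?_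
  obtain ⟨r, hr⟩ := hK.isBounded.subset_closedBall (0 : (EuclideanSpace ℝ (Fin 3)))
  obtain ⟨m, hm⟩ := exists_nat_ge (max |s| r)
  have hsm : s ∈ Icc (-(m : ℝ)) m := by
    have : |s| ≤ m := (le_max_left _ _).trans hm
    rw [abs_le] at this
    exact ⟨this.1, this.2⟩
  exact (hs m hsm).mono_set (hr.trans (closedBall_subset_closedBall ((le_max_right _ _).trans hm)))

/-- A pairing `⟪f, w⟫` of a locally integrable slice with a continuous field vanishing off a
compact set is integrable. [folklore] -/
theorem integrable_inner_slice {f w : (EuclideanSpace ℝ (Fin 3)) → (EuclideanSpace ℝ (Fin 3))} (hf : LocallyIntegrable f volume)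
    (hw : Continuous w) {K : Set (EuclideanSpace ℝ (Fin 3))} (hK : IsCompact K) (hwK : ∀ y ∉ K, w y = 0) :
    Integrable (fun y => ⟪f y, w y⟫) (volume : Measure (EuclideanSpace ℝ (Fin 3))) := by
  have hfK : IntegrableOn f K volume := hf.integrableOn_isCompact hK
  obtain ⟨C, hC⟩ := hw.bounded_above_of_compact_support (HasCompactSupport.intro hK hwK)
  have hsupp : support (fun y => ⟪f y, w y⟫) ⊆ K := by
    intro y hy
    by_contra hyK
    exact hy (by simp [hwK y hyK])
  refine (integrableOn_iff_integrable_of_support_subset hsupp).1 ?_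
  refine Integrable.mono' (hfK.norm.mul_const C)
    (hfK.aestronglyMeasurable.inner hw.aestronglyMeasurable.restrict) ?_
  filter_upwards with y
  exact (norm_inner_le_norm _ _).trans (mul_le_mul_of_nonneg_left (hC y) (norm_nonneg _))

/-- Evaluating a locally integrable operator field at a fixed vector gives a locally integrable
field. [folklore] -/
theorem locallyIntegrable_clm_apply {X : Type*} [MeasurableSpace X] [TopologicalSpace X]
    {μ : Measure X} {Gs : X → (EuclideanSpace ℝ (Fin 3)) →L[ℝ] (EuclideanSpace ℝ (Fin 3))} (hG : LocallyIntegrable Gs μ) (v : (EuclideanSpace ℝ (Fin 3))) :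
    LocallyIntegrable (fun x => Gs x v) μ := by
  have h := (ContinuousLinearMap.apply ℝ (EuclideanSpace ℝ (Fin 3)) v).locallyIntegrableOn_comp
    (locallyIntegrableOn_univ.2 hG)
  have h2 : LocallyIntegrable ((ContinuousLinearMap.apply ℝ (EuclideanSpace ℝ (Fin 3)) v) ∘ Gs) μ :=
    locallyIntegrableOn_univ.1 h
  have e : ((ContinuousLinearMap.apply ℝ (EuclideanSpace ℝ (Fin 3)) v) ∘ Gs) = fun x => Gs x v := by
    funext x; simp
  rwa [e] at h2

/-- A Frobenius pairing `Gs : D` of a locally integrable operator slice with a continuous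
operator field vanishing off a compact set is integrable. [folklore] -/
theorem integrable_frobeniusInner_slice {Gs D : (EuclideanSpace ℝ (Fin 3)) → (EuclideanSpace ℝ (Fin 3)) →L[ℝ] (EuclideanSpace ℝ (Fin 3))}
    (hG : LocallyIntegrable Gs volume) (hD : Continuous D) {K : Set (EuclideanSpace ℝ (Fin 3))} (hK : IsCompact K)
    (hDK : ∀ y ∉ K, D y = 0) :
    Integrable (fun y => frobeniusInner (Gs y) (D y)) (volume : Measure (EuclideanSpace ℝ (Fin 3))) := by
  simp only [frobeniusInner]
  refine integrable_finsetSum _ fun i _ => ?_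
  have h1 : LocallyIntegrable (fun y => Gs y (stdOrthonormalBasis ℝ (EuclideanSpace ℝ (Fin 3)) i)) volume :=
    locallyIntegrable_clm_apply hG _
  exact integrable_inner_slice h1 (hD.clm_apply continuous_const) hK fun y hy => by
    simp [hDK y hy]

variable {U F : ℝ → (EuclideanSpace ℝ (Fin 3)) → (EuclideanSpace ℝ (Fin 3))} {G : ℝ → (EuclideanSpace ℝ (Fin 3)) → (EuclideanSpace ℝ (Fin 3)) →L[ℝ] (EuclideanSpace ℝ (Fin 3))} {W : ℝ → (EuclideanSpace ℝ (Fin 3)) → (EuclideanSpace ℝ (Fin 3))}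

/-- **Integrability of the three space–time pairings** `⟪U, ∂ₛχ⟫`, `∇U : ∇χ`, `⟪F, χ⟫` against a
test field `χ` on `ℝ × ℝ³`, for locally integrable `U`, `G`, `F`. [folklore] -/
theorem integrable_pairings (hU : LocallyIntegrable (uncurry U) volume)
    (hG : LocallyIntegrable (uncurry G) volume) (hF : LocallyIntegrable (uncurry F) volume)
    {χ : ℝ → (EuclideanSpace ℝ (Fin 3)) → (EuclideanSpace ℝ (Fin 3))} (hχ : IsSpaceTimeTestOn (⊤ : Opens (ℝ × (EuclideanSpace ℝ (Fin 3)))) χ) :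
    Integrable (fun z : ℝ × (EuclideanSpace ℝ (Fin 3)) => ⟪U z.1 z.2, timeDeriv χ z.1 z.2⟫) (volume : Measure (ℝ × (EuclideanSpace ℝ (Fin 3)))) ∧
    Integrable (fun z : ℝ × (EuclideanSpace ℝ (Fin 3)) => frobeniusInner (G z.1 z.2) (fderiv ℝ (χ z.1) z.2))
      (volume : Measure (ℝ × (EuclideanSpace ℝ (Fin 3)))) ∧
    Integrable (fun z : ℝ × (EuclideanSpace ℝ (Fin 3)) => ⟪F z.1 z.2, χ z.1 z.2⟫) (volume : Measure (ℝ × (EuclideanSpace ℝ (Fin 3)))) := by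
  have hK : IsCompact (tsupport (uncurry χ)) := hχ.hasCompactSupport
  have hKQ : tsupport (uncurry χ) ⊆ ((⊤ : Opens (ℝ × (EuclideanSpace ℝ (Fin 3)))) : Set (ℝ × (EuclideanSpace ℝ (Fin 3)))) := fun _ _ => trivial
  refine ⟨?_, ?_, ?_⟩
  · exact integrable_inner_of_locallyIntegrableOn (hU.locallyIntegrableOn _)
      (w := uncurry (timeDeriv χ)) hχ.timeDeriv_top.contDiff.continuous hK hKQ fun z hz =>
        IsSpaceTimeTestOn.timeDeriv_eq_zero_of_notMem (ψ := χ) (t := z.1) (x := z.2) hz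
  · simp only [frobeniusInner]
    refine integrable_finsetSum _ fun i _ => ?_
    have h1 : LocallyIntegrableOn (uncurry fun t x => G t x (stdOrthonormalBasis ℝ (EuclideanSpace ℝ (Fin 3)) i))
        ((⊤ : Opens (ℝ × (EuclideanSpace ℝ (Fin 3)))) : Set (ℝ × (EuclideanSpace ℝ (Fin 3)))) volume :=
      (locallyIntegrable_clm_apply (Gs := uncurry G) hG
        (stdOrthonormalBasis ℝ (EuclideanSpace ℝ (Fin 3)) i)).locallyIntegrableOn _
    have hD : Continuous fun z : ℝ × (EuclideanSpace ℝ (Fin 3)) => fderiv ℝ (χ z.1) z.2 := hχ.fderiv_top.contDiff.continuous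
    exact integrable_inner_of_locallyIntegrableOn h1
      (w := fun z : ℝ × (EuclideanSpace ℝ (Fin 3)) => fderiv ℝ (χ z.1) z.2 (stdOrthonormalBasis ℝ (EuclideanSpace ℝ (Fin 3)) i))
      (hD.clm_apply continuous_const) hK hKQ fun z hz => by
        simp [IsSpaceTimeTestOn.fderiv_slice_eq_zero_of_notMem hz]
  · exact integrable_inner_of_locallyIntegrableOn (hF.locallyIntegrableOn _)
      (w := uncurry χ) hχ.contDiff.continuous hK hKQ fun z hz =>
        (image_eq_zero_of_notMem_tsupport hz : uncurry χ z = 0)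

/-- **The integrand of the profile pairing `⟨LW(s), χ(s)⟩` is continuous with compact support**
on `ℝ × ℝ³` for a `C¹` profile and a test field `χ`, hence integrable, with
`s ↦ ⟨LW(s), χ(s)⟩` integrable on `ℝ`. [folklore] -/
theorem integrable_lerayPairing_integrand (hW : ContDiff ℝ 1 (uncurry W))
    {χ : ℝ → (EuclideanSpace ℝ (Fin 3)) → (EuclideanSpace ℝ (Fin 3))} (hχ : IsSpaceTimeTestOn (⊤ : Opens (ℝ × (EuclideanSpace ℝ (Fin 3)))) χ) :
    Continuous (fun z : ℝ × (EuclideanSpace ℝ (Fin 3)) => ⟪timeDeriv W z.1 z.2 - W z.1 z.2 - fderiv ℝ (W z.1) z.2 z.2,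
        χ z.1 z.2⟫ + frobeniusInner (fderiv ℝ (W z.1) z.2) (fderiv ℝ (χ z.1) z.2)) ∧
    Integrable (fun z : ℝ × (EuclideanSpace ℝ (Fin 3)) => ⟪timeDeriv W z.1 z.2 - W z.1 z.2 - fderiv ℝ (W z.1) z.2 z.2,
        χ z.1 z.2⟫ + frobeniusInner (fderiv ℝ (W z.1) z.2) (fderiv ℝ (χ z.1) z.2))
      (volume : Measure (ℝ × (EuclideanSpace ℝ (Fin 3)))) ∧
    Integrable (fun s => lerayPairing W s (χ s)) (volume : Measure ℝ) := by
  have happ : Continuous (uncurry fun (L : (EuclideanSpace ℝ (Fin 3)) →L[ℝ] (EuclideanSpace ℝ (Fin 3))) (v : (EuclideanSpace ℝ (Fin 3))) => L v) :=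
    isBoundedBilinearMap_apply.continuous
  have cW : Continuous fun z : ℝ × (EuclideanSpace ℝ (Fin 3)) => W z.1 z.2 := hW.continuous
  have cWt : Continuous fun z : ℝ × (EuclideanSpace ℝ (Fin 3)) => timeDeriv W z.1 z.2 := continuous_timeDeriv_of_contDiff_one hW
  have cDW : Continuous fun z : ℝ × (EuclideanSpace ℝ (Fin 3)) => fderiv ℝ (W z.1) z.2 := continuous_fderiv_slice_of_contDiff hW
  have cDWy : Continuous fun z : ℝ × (EuclideanSpace ℝ (Fin 3)) => fderiv ℝ (W z.1) z.2 z.2 := happ.comp (cDW.prodMk continuous_snd)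
  have cχ : Continuous fun z : ℝ × (EuclideanSpace ℝ (Fin 3)) => χ z.1 z.2 := hχ.contDiff.continuous
  have cDχ : Continuous fun z : ℝ × (EuclideanSpace ℝ (Fin 3)) => fderiv ℝ (χ z.1) z.2 := hχ.fderiv_top.contDiff.continuous
  have hc : Continuous (fun z : ℝ × (EuclideanSpace ℝ (Fin 3)) => ⟪timeDeriv W z.1 z.2 - W z.1 z.2 - fderiv ℝ (W z.1) z.2 z.2,
      χ z.1 z.2⟫ + frobeniusInner (fderiv ℝ (W z.1) z.2) (fderiv ℝ (χ z.1) z.2)) :=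
    (((cWt.sub cW).sub cDWy).inner cχ).add (continuous_frobeniusInner_comp cDW cDχ)
  have hK : IsCompact (tsupport (uncurry χ)) := hχ.hasCompactSupport
  have h0 : ∀ z, z ∉ tsupport (uncurry χ) →
      ⟪timeDeriv W z.1 z.2 - W z.1 z.2 - fderiv ℝ (W z.1) z.2 z.2, χ z.1 z.2⟫ +
        frobeniusInner (fderiv ℝ (W z.1) z.2) (fderiv ℝ (χ z.1) z.2) = 0 := by
    intro z hz
    have h1 : χ z.1 z.2 = 0 := (image_eq_zero_of_notMem_tsupport hz : uncurry χ z = 0)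
    rw [h1, IsSpaceTimeTestOn.fderiv_slice_eq_zero_of_notMem hz, inner_zero_right,
      frobeniusInner_zero_right, add_zero]
  have hi : Integrable (fun z : ℝ × (EuclideanSpace ℝ (Fin 3)) => ⟪timeDeriv W z.1 z.2 - W z.1 z.2 - fderiv ℝ (W z.1) z.2 z.2,
      χ z.1 z.2⟫ + frobeniusInner (fderiv ℝ (W z.1) z.2) (fderiv ℝ (χ z.1) z.2))
      (volume : Measure (ℝ × (EuclideanSpace ℝ (Fin 3)))) :=
    hc.integrable_of_hasCompactSupport (HasCompactSupport.intro hK h0)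
  refine ⟨hc, hi, ?_⟩
  have h := hi.integral_prod_left
  exact h

end Data

/-! ### Linearity of the profile pairing in the test slot -/

section Pairing

variable {T : ℝ} {W : ℝ → (EuclideanSpace ℝ (Fin 3)) → (EuclideanSpace ℝ (Fin 3))} {s : ℝ}

/-- **`⟨LW(s), Σₙ ζₙ⟩ = Σₙ ⟨LW(s), ζₙ⟩`** for `C¹` compactly supported `ζₙ`. [folklore] -/
theorem lerayPairing_finset_sum (hW : ContDiff ℝ 1 (uncurry W)) {ι : Type*} (S : Finset ι)
    {ζ : ι → (EuclideanSpace ℝ (Fin 3)) → (EuclideanSpace ℝ (Fin 3))} (hζ : ∀ n, ContDiff ℝ 1 (ζ n)) (hζc : ∀ n, HasCompactSupport (ζ n)) :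
    lerayPairing W s (fun y => ∑ n ∈ S, ζ n y) = ∑ n ∈ S, lerayPairing W s (ζ n) := by
  have hr := SliceRegular.of_contDiff hW s
  have hd : ∀ y, ∀ n ∈ S, DifferentiableAt ℝ (ζ n) y := fun y n _ =>
    ((hζ n).differentiable one_ne_zero) y
  have hpt : ∀ y, lerayIntegrand W s (fun y => ∑ n ∈ S, ζ n y) y =
      ∑ n ∈ S, lerayIntegrand W s (ζ n) y := by
    intro y
    simp only [lerayIntegrand, fderiv_fun_sum (hd y), frobeniusInner_sum_right, inner_sum,
      ← Finset.sum_add_distrib]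
  simp_rw [lerayPairing_eq_integral, hpt]
  exact integral_finsetSum _ fun n _ =>
    integrable_lerayIntegrand (hζ n) (hζc n) hr.continuous hr.continuous_timeDeriv
      hr.continuous_fderiv

/-- **`⟨LW(s), a ζ⟩ = a ⟨LW(s), ζ⟩`** for differentiable `ζ`. [folklore] -/
theorem lerayPairing_const_smul {ζ : (EuclideanSpace ℝ (Fin 3)) → (EuclideanSpace ℝ (Fin 3))} (hζ : Differentiable ℝ ζ) (a : ℝ) :
    lerayPairing W s (fun y => a • ζ y) = a * lerayPairing W s ζ := by
  have hpt : ∀ y, lerayIntegrand W s (fun y => a • ζ y) y = a * lerayIntegrand W s ζ y := by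
    intro y
    have hd : fderiv ℝ (fun y => a • ζ y) y = a • fderiv ℝ ζ y := fderiv_const_smul (hζ y) a
    simp only [lerayIntegrand, hd, frobeniusInner_smul_right, real_inner_smul_right]
    ring
  simp_rw [lerayPairing_eq_integral, hpt]
  exact integral_const_mul _ _

end Pairing

/-! ### One period against `𝒟_T` ⟹ the whole line against compactly supported fields -/

section PeriodToLine

variable {T : ℝ} {U F : ℝ → (EuclideanSpace ℝ (Fin 3)) → (EuclideanSpace ℝ (Fin 3))} {G : ℝ → (EuclideanSpace ℝ (Fin 3)) → (EuclideanSpace ℝ (Fin 3)) →L[ℝ] (EuclideanSpace ℝ (Fin 3))} {W : ℝ → (EuclideanSpace ℝ (Fin 3)) → (EuclideanSpace ℝ (Fin 3))}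

/-- A time translate of a space–time test field on `ℝ × ℝ³` is a space–time test field.
[folklore] -/
theorem isSpaceTimeTestOn_comp_add {F' : Type*} [NormedAddCommGroup F'] [NormedSpace ℝ F']
    {ψ : ℝ → (EuclideanSpace ℝ (Fin 3)) → F'} (hψ : IsSpaceTimeTestOn (⊤ : Opens (ℝ × (EuclideanSpace ℝ (Fin 3)))) ψ) (a : ℝ) :
    IsSpaceTimeTestOn (⊤ : Opens (ℝ × (EuclideanSpace ℝ (Fin 3)))) (fun t y => ψ (t + a) y) := by
  set θ : ℝ × (EuclideanSpace ℝ (Fin 3)) ≃ₜ ℝ × (EuclideanSpace ℝ (Fin 3)) := (Homeomorph.addRight a).prodCongr (Homeomorph.refl (EuclideanSpace ℝ (Fin 3))) with hθ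
  have hfun : (uncurry fun t y => ψ (t + a) y) = uncurry ψ ∘ θ := by
    funext z
    simp [hθ, uncurry]
  refine ⟨?_, ?_, by simp⟩
  · rw [hfun]
    exact hψ.contDiff.comp
      ((contDiff_fst.add contDiff_const).prodMk contDiff_snd : ContDiff ℝ (⊤ : ℕ∞) (θ : ℝ × (EuclideanSpace ℝ (Fin 3)) → ℝ × (EuclideanSpace ℝ (Fin 3))))
  · rw [hfun]
    exact hψ.hasCompactSupport.comp_homeomorph θ

/-- **Period ⟹ line.** Let `U`, `F` be locally integrable `T`-periodic fields, `G` a locally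
integrable `T`-periodic operator field and `W` a `C¹` `T`-periodic profile on `ℝ × ℝ³` (`T > 0`).
If the weak formulation over one period
`∫₀ᵀ (∫ (⟪U, ∂ₛf⟫ − G : ∇f + ⟪F, f⟫) dy − ⟨LW(s), f(s)⟩) ds = 0` holds for every `f ∈ 𝒟_T`,
then `∫_ℝ (∫ (⟪U, ∂ₛψ⟫ − G : ∇ψ + ⟪F, ψ⟫) dy − ⟨LW(s), ψ(s)⟩) ds = 0` for every space–time test
field `ψ` on `ℝ × ℝ³` with divergence-free slices (apply the hypothesis to the time-periodisation
`f = Σₙ ψ(· + nT)` and unfold the period integral by periodicity of the data). [cite: BradshawTsai2017AHP, §2 (weak formulation against 𝒟_T, proof of Thm 2.4)] -/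
theorem weakForm_line_of_period (hT : 0 < T)
    (hU : LocallyIntegrable (uncurry U) volume) (hUper : ∀ s y, U (s + T) y = U s y)
    (hG : LocallyIntegrable (uncurry G) volume) (hGper : ∀ s y, G (s + T) y = G s y)
    (hF : LocallyIntegrable (uncurry F) volume) (hFper : ∀ s y, F (s + T) y = F s y)
    (hW : ContDiff ℝ 1 (uncurry W)) (hWper : ∀ s y, W (s + T) y = W s y)
    (hiii : ∀ f : ℝ → (EuclideanSpace ℝ (Fin 3)) → (EuclideanSpace ℝ (Fin 3)), IsPeriodicDivFreeTest T f →
      ∫ s in Ioo 0 T, ((∫ y, (⟪U s y, timeDeriv f s y⟫ -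
          frobeniusInner (G s y) (fderiv ℝ (f s) y) + ⟪F s y, f s y⟫)) -
        lerayPairing W s (f s)) = 0)
    {ψ : ℝ → (EuclideanSpace ℝ (Fin 3)) → (EuclideanSpace ℝ (Fin 3))} (hψ : IsSpaceTimeTestOn (⊤ : Opens (ℝ × (EuclideanSpace ℝ (Fin 3)))) ψ)
    (hdiv : ∀ t, VectorCalculus.IsDivFree (ψ t)) :
    ∫ s, ((∫ y, (⟪U s y, timeDeriv ψ s y⟫ -
          frobeniusInner (G s y) (fderiv ℝ (ψ s) y) + ⟪F s y, ψ s y⟫)) -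
        lerayPairing W s (ψ s)) = 0 := by
  obtain ⟨f, S, M, hfD, htime, hcov, hfS, hftS, hfDS⟩ := exists_periodization hT hψ hdiv
  -- the line functional
  set c : ℝ → ℝ := fun s => (∫ y, (⟪U s y, timeDeriv ψ s y⟫ -
      frobeniusInner (G s y) (fderiv ℝ (ψ s) y) + ⟪F s y, ψ s y⟫)) - lerayPairing W s (ψ s)
    with hc
  show ∫ s, c s = 0
  -- (1) `c` is integrable
  have hci : Integrable c := by
    obtain ⟨i1, i2, i3⟩ := integrable_pairings hU hG hF hψ
    obtain ⟨-, -, i4⟩ := integrable_lerayPairing_integrand hW hψ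
    have h : Integrable (fun s => ∫ y, (⟪U s y, timeDeriv ψ s y⟫ -
        frobeniusInner (G s y) (fderiv ℝ (ψ s) y) + ⟪F s y, ψ s y⟫)) (volume : Measure ℝ) :=
      ((i1.sub i2).add i3).integral_prod_left
    exact h.sub i4
  -- (2) `c` vanishes off `[-M, M]`, hence off the cells indexed by `S`
  have hc0 : ∀ t, M < |t| → c t = 0 := by
    intro t ht
    have h1 : ψ t = fun _ => 0 := funext fun y => (htime t y ht).1
    have h2 : ∀ y, timeDeriv ψ t y = 0 := fun y => (htime t y ht).2.1
    simp only [hc, lerayPairing, h1, h2, fderiv_fun_const, Pi.zero_apply, inner_zero_right,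
      frobeniusInner_zero_right]
    simp
  have hcS : ∀ t, c t ≠ 0 → ∃ n ∈ S, t ∈ Ioc ((n : ℝ) * T) ((n : ℝ) * T + T) := by
    intro t ht
    have htM : |t| ≤ M := by
      by_contra h
      push Not at h
      exact ht (hc0 t h)
    exact ⟨_, hcov _ t htM (mem_Ioc_period hT t), mem_Ioc_period hT t⟩
  -- (3) unfolding the line integral onto one period
  have hunf := integral_eq_setIntegral_sum_comp_add_int_mul hT hci S hcS
  -- (4) on `(0, T)` the period functional of `f` is `Σ_{n ∈ S} c(s + nT)` (a.e.: where the slices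
  -- of the data are locally integrable)
  have hr : ∀ s, SliceRegular W s := SliceRegular.of_contDiff hW
  have hψn : ∀ n : ℤ, IsSpaceTimeTestOn (⊤ : Opens (ℝ × (EuclideanSpace ℝ (Fin 3)))) (fun t y => ψ (t + n * T) y) :=
    fun n => isSpaceTimeTestOn_comp_add hψ _
  have hae : ∀ᵐ s : ℝ, s ∈ Ioo (0 : ℝ) T →
      ((∫ y, (⟪U s y, timeDeriv f s y⟫ - frobeniusInner (G s y) (fderiv ℝ (f s) y) +
        ⟪F s y, f s y⟫)) - lerayPairing W s (f s)) = ∑ n ∈ S, c (s + n * T) := by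
    filter_upwards [ae_locallyIntegrable_slice hU, ae_locallyIntegrable_slice hG,
      ae_locallyIntegrable_slice hF] with s hUs hGs hFs hs
    have hsw : s ∈ Ioo (-T) (2 * T) := ⟨by linarith [hs.1], by linarith [hs.2]⟩
    -- the summands at time `s`
    set g : ℤ → (EuclideanSpace ℝ (Fin 3)) → ℝ := fun n y => ⟪U s y, timeDeriv ψ (s + n * T) y⟫ -
      frobeniusInner (G s y) (fderiv ℝ (ψ (s + n * T)) y) + ⟪F s y, ψ (s + n * T) y⟫ with hg
    have hpt : ∀ y, (⟪U s y, timeDeriv f s y⟫ - frobeniusInner (G s y) (fderiv ℝ (f s) y) +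
        ⟪F s y, f s y⟫) = ∑ n ∈ S, g n y := by
      intro y
      rw [hfS s hsw y, hftS s hsw y, hfDS s hsw y, inner_sum, inner_sum, frobeniusInner_sum_right]
      simp only [hg, Finset.sum_add_distrib, Finset.sum_sub_distrib]
    -- integrability of the summands
    have hgi : ∀ n ∈ S, Integrable (g n) (volume : Measure (EuclideanSpace ℝ (Fin 3))) := by
      intro n _
      have hT1 := (hψn n).timeDeriv_top
      have e1 : ∀ y, timeDeriv ψ (s + n * T) y = timeDeriv (fun t y => ψ (t + n * T) y) s y := by
        intro y
        rw [timeDeriv, timeDeriv, ← deriv_comp_add_const]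
      have i1 : Integrable (fun y => ⟪U s y, timeDeriv ψ (s + n * T) y⟫) (volume : Measure (EuclideanSpace ℝ (Fin 3))) := by
        simp_rw [e1]
        exact integrable_inner_slice hUs (hT1.contDiff.continuous.comp
          (continuous_const.prodMk continuous_id)) (hT1.hasCompactSupport_slice s)
          fun y hy => image_eq_zero_of_notMem_tsupport hy
      have i2 : Integrable (fun y => frobeniusInner (G s y) (fderiv ℝ (ψ (s + n * T)) y))
          (volume : Measure (EuclideanSpace ℝ (Fin 3))) :=
        integrable_frobeniusInner_slice hGs
          ((hψ.contDiff_slice _).continuous_fderiv (by simp))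
          (hψ.hasCompactSupport_slice _) fun y hy => fderiv_of_notMem_tsupport ℝ hy
      have i3 : Integrable (fun y => ⟪F s y, ψ (s + n * T) y⟫) (volume : Measure (EuclideanSpace ℝ (Fin 3))) :=
        integrable_inner_slice hFs (hψ.contDiff_slice _).continuous
          (hψ.hasCompactSupport_slice _) fun y hy => image_eq_zero_of_notMem_tsupport hy
      exact (i1.sub i2).add i3
    -- the profile pairing splits
    have hL : lerayPairing W s (f s) = ∑ n ∈ S, lerayPairing W s (ψ (s + n * T)) := by
      have e : f s = fun y => ∑ n ∈ S, ψ (s + n * T) y := funext fun y => hfS s hsw y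
      rw [e]
      exact lerayPairing_finset_sum hW S
        (fun n => (hψ.contDiff_slice _).of_le (by exact_mod_cast le_top))
        fun n => hψ.hasCompactSupport_slice _
    -- periodicity of the data: `c (s + nT)` is the `n`-th summand
    have hcn : ∀ n : ℤ, c (s + n * T) = (∫ y, g n y) - lerayPairing W s (ψ (s + n * T)) := by
      intro n
      have eW : W (s + n * T) = W s := funext fun y => apply_add_int_mul_of_periodic hWper n s y
      have eWt : ∀ y, timeDeriv W (s + n * T) y = timeDeriv W s y := fun y =>
        apply_add_int_mul_of_periodic (H := timeDeriv W) (timeDeriv_add_period hWper) n s y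
      simp only [hc, hg, lerayPairing, apply_add_int_mul_of_periodic hUper n,
        apply_add_int_mul_of_periodic hGper n, apply_add_int_mul_of_periodic hFper n, eW, eWt]
    calc ((∫ y, (⟪U s y, timeDeriv f s y⟫ - frobeniusInner (G s y) (fderiv ℝ (f s) y) +
          ⟪F s y, f s y⟫)) - lerayPairing W s (f s))
        = (∫ y, ∑ n ∈ S, g n y) - ∑ n ∈ S, lerayPairing W s (ψ (s + n * T)) := by
          rw [integral_congr_ae (ae_of_all _ hpt), hL]
      _ = ∑ n ∈ S, ((∫ y, g n y) - lerayPairing W s (ψ (s + n * T))) := by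
          rw [integral_finsetSum _ hgi, Finset.sum_sub_distrib]
      _ = ∑ n ∈ S, c (s + n * T) := by simp only [hcn]
  -- (5) conclusion
  have h1 : ∫ s in Ioo 0 T, ((∫ y, (⟪U s y, timeDeriv f s y⟫ -
        frobeniusInner (G s y) (fderiv ℝ (f s) y) + ⟪F s y, f s y⟫)) - lerayPairing W s (f s)) =
      ∫ s in Ioo 0 T, ∑ n ∈ S, c (s + n * T) :=
    setIntegral_congr_ae measurableSet_Ioo hae
  rw [hunf, ← setIntegral_congr_set (Ioo_ae_eq_Ioc (μ := (volume : Measure ℝ))), ← h1]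
  exact hiii f hfD

end PeriodToLine

/-! ### The whole line against compactly supported fields ⟹ one period against `𝒟_T` -/

section LineToPeriod

variable {T : ℝ} {U F : ℝ → (EuclideanSpace ℝ (Fin 3)) → (EuclideanSpace ℝ (Fin 3))} {G : ℝ → (EuclideanSpace ℝ (Fin 3)) → (EuclideanSpace ℝ (Fin 3)) →L[ℝ] (EuclideanSpace ℝ (Fin 3))} {W : ℝ → (EuclideanSpace ℝ (Fin 3)) → (EuclideanSpace ℝ (Fin 3))}

/-- A smooth function vanishing on `(-∞, 0]` and on `[2T, ∞)` has its derivative supported in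
`(0, 2T)` (the zero set of the continuous derivative is closed and contains the two open rays).
[folklore] -/
theorem deriv_eq_zero_of_notMem_Ioo {χ : ℝ → ℝ} (hχs : ContDiff ℝ (⊤ : ℕ∞) χ)
    (hχ0 : ∀ t, t ≤ 0 → χ t = 0) (hχ2 : ∀ t, 2 * T ≤ t → χ t = 0) {t : ℝ}
    (ht : t ∉ Ioo (0 : ℝ) (2 * T)) : deriv χ t = 0 := by
  have hc : Continuous (deriv χ) := hχs.continuous_deriv (by simp)
  have hZ : IsClosed {t : ℝ | deriv χ t = 0} := isClosed_eq hc continuous_const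
  have hneg : Iio (0 : ℝ) ⊆ {t : ℝ | deriv χ t = 0} := by
    intro t ht
    have hev : χ =ᶠ[𝓝 t] fun _ => (0 : ℝ) := by
      filter_upwards [Iio_mem_nhds ht] with t' ht'
      exact hχ0 t' (le_of_lt ht')
    show deriv χ t = 0
    rw [hev.deriv_eq, deriv_const]
  have hpos : Ioi (2 * T) ⊆ {t : ℝ | deriv χ t = 0} := by
    intro t ht
    have hev : χ =ᶠ[𝓝 t] fun _ => (0 : ℝ) := by
      filter_upwards [Ioi_mem_nhds ht] with t' ht'
      exact hχ2 t' (le_of_lt ht')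
    show deriv χ t = 0
    rw [hev.deriv_eq, deriv_const]
  have h1 : Iic (0 : ℝ) ⊆ {t : ℝ | deriv χ t = 0} := by
    rw [← closure_Iio]
    exact hZ.closure_subset_iff.2 hneg
  have h2 : Ici (2 * T) ⊆ {t : ℝ | deriv χ t = 0} := by
    rw [← closure_Ioi]
    exact hZ.closure_subset_iff.2 hpos
  rw [mem_Ioo, not_and_or, not_lt, not_lt] at ht
  rcases ht with ht | ht
  · exact h1 ht
  · exact h2 ht

/-- **Line ⟹ period.** Let `U`, `F` be locally integrable `T`-periodic fields, `G` a locally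
integrable `T`-periodic operator field and `W` a `C¹` `T`-periodic profile on `ℝ × ℝ³` (`T > 0`).
If `∫_ℝ (∫ (⟪U, ∂ₛψ⟫ − G : ∇ψ + ⟪F, ψ⟫) dy − ⟨LW(s), ψ(s)⟩) ds = 0` for every space–time test
field `ψ` on `ℝ × ℝ³` with divergence-free slices, then the weak formulation over one period
`∫₀ᵀ (∫ (⟪U, ∂ₛf⟫ − G : ∇f + ⟪F, f⟫) dy − ⟨LW(s), f(s)⟩) ds = 0` holds for every `f ∈ 𝒟_T` (test
the line identity with `χ(s) f(s, y)` for a smooth cut-off `χ` with `χ(s) + χ(s + T) = 1` on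
`[0, T]`, and fold the line integral onto one period). [cite: BradshawTsai2017AHP, §2 (weak formulation against 𝒟_T, proof of Thm 2.4)] -/
theorem weakForm_period_of_line (hT : 0 < T)
    (hU : LocallyIntegrable (uncurry U) volume) (hUper : ∀ s y, U (s + T) y = U s y)
    (hG : LocallyIntegrable (uncurry G) volume) (hGper : ∀ s y, G (s + T) y = G s y)
    (hF : LocallyIntegrable (uncurry F) volume) (hFper : ∀ s y, F (s + T) y = F s y)
    (hW : ContDiff ℝ 1 (uncurry W)) (hWper : ∀ s y, W (s + T) y = W s y)
    (hline : ∀ ψ : ℝ → (EuclideanSpace ℝ (Fin 3)) → (EuclideanSpace ℝ (Fin 3)), IsSpaceTimeTestOn (⊤ : Opens (ℝ × (EuclideanSpace ℝ (Fin 3)))) ψ →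
      (∀ t, VectorCalculus.IsDivFree (ψ t)) →
      ∫ s, ((∫ y, (⟪U s y, timeDeriv ψ s y⟫ -
          frobeniusInner (G s y) (fderiv ℝ (ψ s) y) + ⟪F s y, ψ s y⟫)) -
        lerayPairing W s (ψ s)) = 0)
    {f : ℝ → (EuclideanSpace ℝ (Fin 3)) → (EuclideanSpace ℝ (Fin 3))} (hf : IsPeriodicDivFreeTest T f) :
    ∫ s in Ioo 0 T, ((∫ y, (⟪U s y, timeDeriv f s y⟫ -
        frobeniusInner (G s y) (fderiv ℝ (f s) y) + ⟪F s y, f s y⟫)) -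
      lerayPairing W s (f s)) = 0 := by
  obtain ⟨χ, hχs, hχ0, hχ2, hχsum, hχder⟩ := exists_smooth_period_cutoff hT
  have hf1 : ContDiff ℝ 1 (uncurry f) := hf.contDiff.of_le (by exact_mod_cast le_top)
  obtain ⟨Rf, hRf0, hRf⟩ := hf.exists_ball
  have hfd : ∀ s, Differentiable ℝ (f s) := fun s =>
    (hf.contDiff.comp (contDiff_prodMk_right s)).differentiable (by simp)
  -- supports of `χ` and `χ'`
  have hχsupp : ∀ t, χ t ≠ 0 → t ∈ Ioo (0 : ℝ) (2 * T) := by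
    intro t ht
    by_contra h
    rw [mem_Ioo, not_and_or, not_lt, not_lt] at h
    rcases h with h | h
    · exact ht (hχ0 t h)
    · exact ht (hχ2 t h)
  have hχ'supp : ∀ t, deriv χ t ≠ 0 → t ∈ Ioo (0 : ℝ) (2 * T) := by
    intro t ht
    by_contra h
    exact ht (deriv_eq_zero_of_notMem_Ioo hχs hχ0 hχ2 h)
  -- a smooth function of time supported in `(0, 2T)` times `f` is a space–time test field with
  -- divergence-free slices
  have htest : ∀ ρ : ℝ → ℝ, ContDiff ℝ (⊤ : ℕ∞) ρ → (∀ t, ρ t ≠ 0 → t ∈ Ioo (0 : ℝ) (2 * T)) →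
      IsSpaceTimeTestOn (⊤ : Opens (ℝ × (EuclideanSpace ℝ (Fin 3)))) (fun s y => ρ s • f s y) ∧
      ∀ t, VectorCalculus.IsDivFree (fun y => ρ t • f t y) := by
    intro ρ hρ hρs
    refine ⟨⟨?_, ?_, by simp⟩, fun t y => ?_⟩
    · exact (hρ.comp contDiff_fst).smul hf.contDiff
    · refine HasCompactSupport.intro (isCompact_Icc.prod (isCompact_closedBall (0 : (EuclideanSpace ℝ (Fin 3))) Rf) :
        IsCompact (Icc (0 : ℝ) (2 * T) ×ˢ closedBall (0 : (EuclideanSpace ℝ (Fin 3))) Rf)) ?_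
      rintro ⟨t, y⟩ hz
      simp only [mem_prod, mem_closedBall_zero_iff, not_and_or, not_le] at hz
      show ρ t • f t y = 0
      rcases hz with ht | hy
      · have : ρ t = 0 := by
          by_contra h
          exact ht (Ioo_subset_Icc_self (hρs t h))
        rw [this, zero_smul]
      · rw [(hRf t y (fun h => by rw [mem_ball_zero_iff] at h; linarith)).1, smul_zero]
    · show VectorCalculus.divergence (fun y => ρ t • f t y) y = 0
      rw [VectorCalculus.divergence, show (fun y => ρ t • f t y) = ρ t • f t from rfl,
        fderiv_const_smul (hfd t y), ContinuousLinearMap.toLinearMap_smul, map_smul,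
        smul_eq_mul]
      have := hf.divFree t y
      rw [VectorCalculus.divergence] at this
      rw [this, mul_zero]
  -- the cut-off test field `ψ = χ f` and the auxiliary `ψ' = χ' f`
  set ψ : ℝ → (EuclideanSpace ℝ (Fin 3)) → (EuclideanSpace ℝ (Fin 3)) := fun s y => χ s • f s y with hψdef
  have hψap : ∀ s y, ψ s y = χ s • f s y := fun s y => rfl
  obtain ⟨hψ, hψdiv⟩ := htest χ hχs hχsupp
  set ψ' : ℝ → (EuclideanSpace ℝ (Fin 3)) → (EuclideanSpace ℝ (Fin 3)) := fun s y => deriv χ s • f s y with hψ'def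
  obtain ⟨hψ', -⟩ := htest (deriv χ) (contDiff_infty_iff_deriv.1 hχs).2 hχ'supp
  -- the period functional `A` and the pairing `B`
  set A : ℝ → ℝ := fun s => (∫ y, (⟪U s y, timeDeriv f s y⟫ -
      frobeniusInner (G s y) (fderiv ℝ (f s) y) + ⟪F s y, f s y⟫)) - lerayPairing W s (f s) with hA
  set B : ℝ → ℝ := fun s => ∫ y, ⟪U s y, f s y⟫ with hB
  show ∫ s in Ioo 0 T, A s = 0
  -- periodicity of `A` and `B`
  have hfper' : ∀ s, f (s + T) = f s := fun s => funext (hf.periodic s)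
  have hftper : ∀ s y, timeDeriv f (s + T) y = timeDeriv f s y := timeDeriv_add_period hf.periodic
  have hAper : ∀ s, A (s + T) = A s := by
    intro s
    simp only [hA, lerayPairing, hUper, hGper, hFper, hWper, hfper', hftper,
      slice_add_period hWper, timeDeriv_add_period hWper]
  have hBper : ∀ s, B (s + T) = B s := by
    intro s
    simp only [hB, hUper, hfper']
  -- time derivative and slice derivative of `ψ`
  have hψt : ∀ s y, timeDeriv ψ s y = χ s • timeDeriv f s y + deriv χ s • f s y := by
    intro s y
    have h1 : HasDerivAt χ (deriv χ s) s := ((hχs.differentiable (by simp)) s).hasDerivAt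
    have h2 : HasDerivAt (fun τ => f τ y) (timeDeriv f s y) s := by
      rw [timeDeriv]
      exact (hasDerivAt_profile_time hf1 s y).differentiableAt.hasDerivAt
    have h3 : HasDerivAt (fun τ => χ τ • f τ y) (χ s • timeDeriv f s y + deriv χ s • f s y) s :=
      h1.smul h2
    rw [timeDeriv]
    exact h3.deriv
  have hψD : ∀ s y, fderiv ℝ (ψ s) y = χ s • fderiv ℝ (f s) y := by
    intro s y
    show fderiv ℝ (fun y => χ s • f s y) y = _
    rw [show (fun y => χ s • f s y) = χ s • f s from rfl, fderiv_const_smul (hfd s y)]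
  -- the line functional of `ψ` is `χ A + χ' B` a.e.
  have hline_ae : ∀ᵐ s : ℝ, ((∫ y, (⟪U s y, timeDeriv ψ s y⟫ -
      frobeniusInner (G s y) (fderiv ℝ (ψ s) y) + ⟪F s y, ψ s y⟫)) - lerayPairing W s (ψ s)) =
      χ s * A s + deriv χ s * B s := by
    filter_upwards [ae_locallyIntegrable_slice hU, ae_locallyIntegrable_slice hG,
      ae_locallyIntegrable_slice hF] with s hUs hGs hFs
    -- integrability of the slice integrands
    have cft : Continuous (timeDeriv f s) :=
      (continuous_timeDeriv_of_contDiff_one hf1).comp (continuous_const.prodMk continuous_id)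
    have cf : Continuous (f s) := hf1.continuous.comp (continuous_const.prodMk continuous_id)
    have cDf : Continuous fun y => fderiv ℝ (f s) y :=
      (continuous_fderiv_slice_of_contDiff hf1).comp (continuous_const.prodMk continuous_id)
    have hK : IsCompact (closedBall (0 : (EuclideanSpace ℝ (Fin 3))) Rf) := isCompact_closedBall _ _
    have hout : ∀ y, y ∉ closedBall (0 : (EuclideanSpace ℝ (Fin 3))) Rf → f s y = 0 ∧ fderiv ℝ (f s) y = 0 ∧
        timeDeriv f s y = 0 := fun y hy =>
      hRf s y fun h => hy (ball_subset_closedBall h)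
    have iA1 : Integrable (fun y => ⟪U s y, timeDeriv f s y⟫) (volume : Measure (EuclideanSpace ℝ (Fin 3))) :=
      integrable_inner_slice hUs cft hK fun y hy => (hout y hy).2.2
    have iA2 : Integrable (fun y => frobeniusInner (G s y) (fderiv ℝ (f s) y))
        (volume : Measure (EuclideanSpace ℝ (Fin 3))) :=
      integrable_frobeniusInner_slice hGs cDf hK fun y hy => (hout y hy).2.1
    have iA3 : Integrable (fun y => ⟪F s y, f s y⟫) (volume : Measure (EuclideanSpace ℝ (Fin 3))) :=
      integrable_inner_slice hFs cf hK fun y hy => (hout y hy).1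
    have iB : Integrable (fun y => ⟪U s y, f s y⟫) (volume : Measure (EuclideanSpace ℝ (Fin 3))) :=
      integrable_inner_slice hUs cf hK fun y hy => (hout y hy).1
    have iA : Integrable (fun y => χ s * (⟪U s y, timeDeriv f s y⟫ -
        frobeniusInner (G s y) (fderiv ℝ (f s) y) + ⟪F s y, f s y⟫)) (volume : Measure (EuclideanSpace ℝ (Fin 3))) :=
      ((iA1.sub iA2).add iA3).const_mul (χ s)
    have iB' : Integrable (fun y => deriv χ s * ⟪U s y, f s y⟫) (volume : Measure (EuclideanSpace ℝ (Fin 3))) :=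
      iB.const_mul (deriv χ s)
    -- pointwise splitting of the integrand
    have hpt : ∀ y, (⟪U s y, timeDeriv ψ s y⟫ - frobeniusInner (G s y) (fderiv ℝ (ψ s) y) +
        ⟪F s y, ψ s y⟫) = χ s * (⟪U s y, timeDeriv f s y⟫ -
          frobeniusInner (G s y) (fderiv ℝ (f s) y) + ⟪F s y, f s y⟫) +
          deriv χ s * ⟪U s y, f s y⟫ := by
      intro y
      rw [hψt, hψD, hψap, inner_add_right, real_inner_smul_right, real_inner_smul_right,
        real_inner_smul_right, frobeniusInner_smul_right]
      ring
    have hL : lerayPairing W s (ψ s) = χ s * lerayPairing W s (f s) := by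
      show lerayPairing W s (fun y => χ s • f s y) = _
      exact lerayPairing_const_smul (hfd s) _
    rw [integral_congr_ae (ae_of_all _ hpt), integral_add iA iB', integral_const_mul,
      integral_const_mul, hL]
    simp only [hA, hB]
    ring
  -- integrability of `χ A` and `χ' B` on the line
  have hi_line : Integrable (fun s => (∫ y, (⟪U s y, timeDeriv ψ s y⟫ -
      frobeniusInner (G s y) (fderiv ℝ (ψ s) y) + ⟪F s y, ψ s y⟫)) - lerayPairing W s (ψ s))
      (volume : Measure ℝ) := by
    obtain ⟨i1, i2, i3⟩ := integrable_pairings hU hG hF hψ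
    obtain ⟨-, -, i4⟩ := integrable_lerayPairing_integrand hW hψ
    have h : Integrable (fun s => ∫ y, (⟪U s y, timeDeriv ψ s y⟫ -
        frobeniusInner (G s y) (fderiv ℝ (ψ s) y) + ⟪F s y, ψ s y⟫)) (volume : Measure ℝ) :=
      ((i1.sub i2).add i3).integral_prod_left
    exact h.sub i4
  have hi_B : Integrable (fun s => deriv χ s * B s) (volume : Measure ℝ) := by
    obtain ⟨-, -, i3⟩ := integrable_pairings hF hG hU hψ'
    have h : Integrable (fun s => ∫ y, ⟪U s y, ψ' s y⟫) (volume : Measure ℝ) :=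
      i3.integral_prod_left
    refine h.congr (ae_of_all _ fun s => ?_)
    show (∫ y, ⟪U s y, deriv χ s • f s y⟫) = deriv χ s * B s
    simp only [hB, real_inner_smul_right]
    exact integral_const_mul _ _
  have hi_A : Integrable (fun s => χ s * A s) (volume : Measure ℝ) := by
    refine (hi_line.sub hi_B).congr ?_
    filter_upwards [hline_ae] with s hs
    rw [Pi.sub_apply, hs]
    ring
  -- the cells `n = 0, 1` carry `(0, 2T)`
  have hcells : ∀ t, t ∈ Ioo (0 : ℝ) (2 * T) →
      ∃ n ∈ ({0, 1} : Finset ℤ), t ∈ Ioc ((n : ℝ) * T) ((n : ℝ) * T + T) := by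
    intro t ht
    by_cases h1 : t ≤ T
    · refine ⟨0, by simp, ?_⟩
      push_cast
      rw [zero_mul, zero_add]
      exact ⟨ht.1, h1⟩
    · refine ⟨1, by simp, ?_⟩
      push_cast
      rw [one_mul]
      exact ⟨not_le.1 h1, by linarith [ht.2]⟩
  have hSA : ∀ t, χ t * A t ≠ 0 →
      ∃ n ∈ ({0, 1} : Finset ℤ), t ∈ Ioc ((n : ℝ) * T) ((n : ℝ) * T + T) :=
    fun t ht => hcells t (hχsupp t (left_ne_zero_of_mul ht))
  have hSB : ∀ t, deriv χ t * B t ≠ 0 →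
      ∃ n ∈ ({0, 1} : Finset ℤ), t ∈ Ioc ((n : ℝ) * T) ((n : ℝ) * T + T) :=
    fun t ht => hcells t (hχ'supp t (left_ne_zero_of_mul ht))
  have hunfA := integral_eq_setIntegral_sum_comp_add_int_mul hT hi_A {0, 1} hSA
  have hunfB := integral_eq_setIntegral_sum_comp_add_int_mul hT hi_B {0, 1} hSB
  -- the line identity for `ψ`
  have h0 : ∫ s, (χ s * A s + deriv χ s * B s) = 0 := by
    rw [← hline ψ hψ hψdiv]
    exact (integral_congr_ae hline_ae).symm
  rw [integral_add hi_A hi_B, hunfA, hunfB] at h0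
  -- evaluate the two folded integrals
  have h01 : (0 : ℤ) ≠ 1 := by norm_num
  have hAfold : ∫ s in Ioc 0 T, ∑ n ∈ ({0, 1} : Finset ℤ), χ (s + n * T) * A (s + n * T) =
      ∫ s in Ioc 0 T, A s := by
    refine setIntegral_congr_fun measurableSet_Ioc fun s hs => ?_
    rw [Finset.sum_pair h01]
    push_cast
    rw [zero_mul, add_zero, one_mul, hAper s, ← add_mul, hχsum s (Ioc_subset_Icc_self hs),
      one_mul]
  have hBfold : ∫ s in Ioc 0 T, ∑ n ∈ ({0, 1} : Finset ℤ),
      deriv χ (s + n * T) * B (s + n * T) = 0 := by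
    rw [← setIntegral_congr_set (Ioo_ae_eq_Ioc (μ := (volume : Measure ℝ)))]
    refine (setIntegral_congr_fun measurableSet_Ioo fun s hs => ?_).trans
      (integral_zero ℝ ℝ)
    rw [Finset.sum_pair h01]
    push_cast
    rw [zero_mul, add_zero, one_mul, hBper s, ← add_mul, hχder s hs, zero_mul]
  rw [hAfold, hBfold, add_zero] at h0
  rw [setIntegral_congr_set (Ioo_ae_eq_Ioc (μ := (volume : Measure ℝ)))]
  exact h0

end LineToPeriod

end BradshawTsai2017

end Literature.Analysis.FluidPDE

end
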